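import Summits.Ventures.CertifiedManyBodySolver.Rows.DopedTLCorr
import HarnessLib

/-!
# The λ-FORM for POINT-GROUP-REDUCED certificates (leg J = SU(2) × D₄): an energy certificate for
# `h₀ + λ·O` with `D₄` labels `γₗ ∈ S` plus a certified cap `e₀ ≤ hi` is an ORBIT-MEAN correlator row for `O`

HONEST FRAMING: first certified bounds on pairing observables; not a superconductivity verdict; every
number certified (two lineages + referee) or labelled float. Theorem-only; zero compute. Seat hubbard-obs-p1
(`prover-hubbard-obs-p1-g0-0`), companion of `Rows/DopedTLCorrLambda.lean` (translation-only certificates)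
for the certificates eng-1's rung 0b-lite lineage A actually produces (op-04 leg-J pipeline, `D₄`-reduced):
the honest conclusion is the `S`-orbit mean (`SquareTTPrimeCorrOrbitLowerRow … S`), exactly as for window
certificates (`HubbardNNNHoppingTorusLimitCorrelator`). The identity is the same relabelling as in the
translation-only file (`Xw := λ•O`, `κ := 1`, `u := hi`, `c := E_cert − hi`); the orbit mean is linear, so
`E_cert − hi − Σ‖aₖ‖ + (Σμ)(n/2 − ν) ≤ λ · |S|⁻¹ Σ_{γ∈S} Re ω_{γΛ'}(Γ(d4Emb γ 0) O)`
(`re_sum_expect_d4_mul_ge_of_lambda_certificate`); `λ > 0` gives `SquareTTPrimeCorrOrbitLowerRow` for `O`,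
`λ < 0` gives it for `−O` (an orbit-mean UPPER bound), M3′ wrappers. For a `D₄`-invariant objective family
(`F_R` on a centred box, orbit sums of `P_d`) the orbit row is the plain row by
`SquareTTPrimeCorrOrbitLowerRow.lowerRow_of_invariant` once the word-level invariance is supplied.
-/

noncomputable section

namespace Summit.Ventures.CertifiedManyBodySolver

open Literature.MathematicalPhysics.QuantumLattice
open Matrix HubbardWave0 Literature.Probability.LatticeModels ThermodynamicLimit Filter Topology
open Literature.MathematicalPhysics.QuantumManyBody.StateRelaxation
open scoped ComplexOrder BigOperators

section LambdaOrbit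

/-- The relabelling identity (as in `Rows/DopedTLCorrLambda.lean`, restated here to keep the files
independent): `λ•O − (E_cert − hi)•1 − D − 1•(hi•1 − E) = λ•O + E − E_cert•1 − D`. -/
private theorem lambda_identity_eq_window_identity' {M : Type*} [AddCommGroup M] [Module ℂ M]
    (O E one D : M) (lam Ecert hi : ℝ) :
    ((lam : ℝ) : ℂ) • O - (((Ecert - hi : ℝ)) : ℂ) • one - D -
        (((1 : ℝ)) : ℂ) • ((((hi : ℝ)) : ℂ) • one - E) =
      ((lam : ℝ) : ℂ) • O + E - ((Ecert : ℝ) : ℂ) • one - D := by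
  push_cast
  module

/-- **`D₄`-reduced λ-form certificate ⇒ `λ ·` (orbit mean of `Re ω(Γ(γ)O)`) is bounded below** for every
torus-limit ground state of the `t–t'` class at density `n` with `energyDensityTT' 1 tp U n ≤ hi`. Data: the
binders of `IsTorusLimitOf.re_sum_expect_d4_ge_of_window_certificate_TT'_ineq` (labels `γₗ ∈ S`, `S ∋ 1`
closed under multiplication) with the identity in the λ-form (objective `λ•O + Γ E_Φ`, constant `E_cert`). -/
theorem re_sum_expect_d4_mul_ge_of_lambda_certificate
    (tp : ℝ) {U : ℝ} (hU : 0 ≤ U) {n : ℝ} (hn0 : 0 ≤ n) (hn2 : n < 2) (lam : ℝ) {hi Ecert : ℝ}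
    (hhi : energyDensityTT' 1 tp U n ≤ hi)
    {Λ Λ' : Finset (Site 2)} (hΛ : Λ ⊆ Λ') (h8 : thicken Λ 1 ⊆ Λ')
    (h0 : thicken ({0} : Finset (Site 2)) 1 ⊆ Λ') (hz : (0 : Site 2) ∈ Λ')
    {S : Finset (DihedralGroup 4)} (h1 : (1 : DihedralGroup 4) ∈ S) (hmul : ∀ a ∈ S, ∀ b ∈ S, a * b ∈ S)
    (Ow : FermionOp Λ') (μ : Fin 2 → ℝ) (ν : ℝ)
    {m : Type*} [Fintype m] [DecidableEq m] {Λm : Matrix m m ℂ} (hΛm : Λm.PosSemidef)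
    (Og : m → FermionOp Λ')
    {κ' : Type*} (s : Finset κ') (B : κ' → FermionOp Λ)
    {ι : Type*} (tt : Finset ι) (γ : ι → DihedralGroup 4) (hγS : ∀ l ∈ tt, γ l ∈ S) (wv : ι → Site 2)
    (hsh : ∀ l, d4ShiftSet (γ l) (wv l) Λ ⊆ Λ') (Y : ι → FermionOp Λ)
    {ρ : Type*} (uu : Finset ρ) (b : ρ → ℂ) (cw : ρ → List (Orb (PolySite Λ') × Bool))
    (hcw : ∀ j ∈ uu, ladderCharge (cw j) ≠ 0 ∨ ladderSpinCharge (cw j) ≠ 0)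
    {δ : Type*} (ah : Finset δ) (dc : δ → ℝ) (V : δ → FermionOp Λ')
    {κ'' : Type*} (w : Finset κ'') (a : κ'' → ℂ) (word : κ'' → List (Orb (PolySite Λ') × Bool))
    (hcert : ((lam : ℝ) : ℂ) • Ow +
        fermionEmbed (PolySite.incl h0) ((hubbardTTPrimeFermionInteraction 1 tp U).meanEnergyObs 1) -
        ((Ecert : ℝ) : ℂ) • (1 : FermionOp Λ') -
        ∑ σ : Fin 2, ((μ σ : ℝ) : ℂ) • (nAt 0 hz σ - ((ν : ℝ) : ℂ) • (1 : FermionOp Λ')) =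
      gramForm Λm Og +
        (∑ k ∈ s, ((hubbardTTPrimeFermionInteraction 1 tp U).localHamiltonian Λ' *
              fermionEmbed (PolySite.incl hΛ) (B k) -
            fermionEmbed (PolySite.incl hΛ) (B k) * (hubbardTTPrimeFermionInteraction 1 tp U).localHamiltonian Λ') +
          ∑ l ∈ tt, (fermionEmbed (PolySite.incl (hsh l)) (fermionEmbed (PolySite.d4Emb (γ l) (wv l) Λ) (Y l)) -
            fermionEmbed (PolySite.incl hΛ) (Y l)) +
          ∑ j ∈ uu, b j • ladderWord (cw j)) +
        (∑ m' ∈ ah, ((dc m' : ℝ) : ℂ) • ((V m')ᴴ - V m') + ∑ k ∈ w, a k • ladderWord (word k)))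
    {Ls : ℕ → ℕ} (hLs : Tendsto Ls atTop atTop)
    {ψ : ∀ L, Fock (Orb (FermionTorus 2 L))}
    (hψ : ∀ j, IsGroundStateInSector (hubbardTorusTT' (Ls j) 1 tp U) (rectN n (Ls j)) 0 (ψ (Ls j)))
    (hψ1 : ∀ j, star (ψ (Ls j)) ⬝ᵥ ψ (Ls j) = 1)
    {ω : InfVolFermionState 2} (hω : ω.IsTorusLimitOf ψ Ls) :
    Ecert - hi - ∑ k ∈ w, ‖a k‖ + (∑ σ : Fin 2, μ σ) * (n / 2 - ν) ≤
      lam * ((S.card : ℝ)⁻¹ *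
        ∑ g ∈ S, (ω.expect (d4ShiftSet g 0 Λ') (fermionEmbed (PolySite.d4Emb g 0 Λ') Ow)).re) := by
  have hcert' : ((lam : ℝ) : ℂ) • Ow - (((Ecert - hi : ℝ)) : ℂ) • (1 : FermionOp Λ') -
      ∑ σ : Fin 2, ((μ σ : ℝ) : ℂ) • (nAt 0 hz σ - ((ν : ℝ) : ℂ) • (1 : FermionOp Λ')) -
      (((1 : ℝ)) : ℂ) • ((((hi : ℝ)) : ℂ) • (1 : FermionOp Λ') -
        fermionEmbed (PolySite.incl h0) ((hubbardTTPrimeFermionInteraction 1 tp U).meanEnergyObs 1)) =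
      gramForm Λm Og +
        (∑ k ∈ s, ((hubbardTTPrimeFermionInteraction 1 tp U).localHamiltonian Λ' *
              fermionEmbed (PolySite.incl hΛ) (B k) -
            fermionEmbed (PolySite.incl hΛ) (B k) * (hubbardTTPrimeFermionInteraction 1 tp U).localHamiltonian Λ') +
          ∑ l ∈ tt, (fermionEmbed (PolySite.incl (hsh l)) (fermionEmbed (PolySite.d4Emb (γ l) (wv l) Λ) (Y l)) -
            fermionEmbed (PolySite.incl hΛ) (Y l)) +
          ∑ j ∈ uu, b j • ladderWord (cw j)) +
        (∑ m' ∈ ah, ((dc m' : ℝ) : ℂ) • ((V m')ᴴ - V m') + ∑ k ∈ w, a k • ladderWord (word k)) := by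
    rw [lambda_identity_eq_window_identity']
    exact hcert
  have h := hω.re_sum_expect_d4_ge_of_window_certificate_TT'_ineq 1 tp hU hn0 hn2 (κ := 1) (u := hi) zero_le_one
    hhi hΛ h8 h0 hz h1 hmul (((lam : ℝ) : ℂ) • Ow) μ ν hΛm Og s B tt γ hγS wv hsh Y uu b cw hcw ah dc V w a word
    hcert' hLs hψ hψ1
  have hsum : ∑ g ∈ S, (ω.expect (d4ShiftSet g 0 Λ')
        (fermionEmbed (PolySite.d4Emb g 0 Λ') (((lam : ℝ) : ℂ) • Ow))).re =
      lam * ∑ g ∈ S, (ω.expect (d4ShiftSet g 0 Λ') (fermionEmbed (PolySite.d4Emb g 0 Λ') Ow)).re := by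
    rw [Finset.mul_sum]
    refine Finset.sum_congr rfl fun g _ => ?_
    rw [fermionEmbed_smul, map_smul, smul_eq_mul, Complex.re_ofReal_mul]
  rw [hsum] at h
  linarith

/-- **λ > 0, `D₄`-reduced**: the λ-form energy certificate is a `SquareTTPrimeCorrOrbitLowerRow … S` for `O`,
with any rational slot `r ≤ (E_cert − hi − Σ‖aₖ‖ + (Σμ)(n/2 − ν))/λ`. -/
theorem SquareTTPrimeCorrOrbitLowerRow.of_lambda_certificate
    (tp : ℝ) {U : ℝ} (hU : 0 ≤ U) {n : ℝ} (hn0 : 0 ≤ n) (hn2 : n < 2) {lam : ℝ} (hlam : 0 < lam)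
    {hi r : ℚ} {Ecert : ℝ}
    {Λ Λ' : Finset (Site 2)} (hΛ : Λ ⊆ Λ') (h8 : thicken Λ 1 ⊆ Λ')
    (h0 : thicken ({0} : Finset (Site 2)) 1 ⊆ Λ') (hz : (0 : Site 2) ∈ Λ')
    {S : Finset (DihedralGroup 4)} (h1 : (1 : DihedralGroup 4) ∈ S) (hmul : ∀ a ∈ S, ∀ b ∈ S, a * b ∈ S)
    (Ow : FermionOp Λ') (μ : Fin 2 → ℝ) (ν : ℝ)
    {m : Type*} [Fintype m] [DecidableEq m] {Λm : Matrix m m ℂ} (hΛm : Λm.PosSemidef)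
    (Og : m → FermionOp Λ')
    {κ' : Type*} (s : Finset κ') (B : κ' → FermionOp Λ)
    {ι : Type*} (tt : Finset ι) (γ : ι → DihedralGroup 4) (hγS : ∀ l ∈ tt, γ l ∈ S) (wv : ι → Site 2)
    (hsh : ∀ l, d4ShiftSet (γ l) (wv l) Λ ⊆ Λ') (Y : ι → FermionOp Λ)
    {ρ : Type*} (uu : Finset ρ) (b : ρ → ℂ) (cw : ρ → List (Orb (PolySite Λ') × Bool))
    (hcw : ∀ j ∈ uu, ladderCharge (cw j) ≠ 0 ∨ ladderSpinCharge (cw j) ≠ 0)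
    {δ : Type*} (ah : Finset δ) (dc : δ → ℝ) (V : δ → FermionOp Λ')
    {κ'' : Type*} (w : Finset κ'') (a : κ'' → ℂ) (word : κ'' → List (Orb (PolySite Λ') × Bool))
    (hcert : ((lam : ℝ) : ℂ) • Ow +
        fermionEmbed (PolySite.incl h0) ((hubbardTTPrimeFermionInteraction 1 tp U).meanEnergyObs 1) -
        ((Ecert : ℝ) : ℂ) • (1 : FermionOp Λ') -
        ∑ σ : Fin 2, ((μ σ : ℝ) : ℂ) • (nAt 0 hz σ - ((ν : ℝ) : ℂ) • (1 : FermionOp Λ')) =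
      gramForm Λm Og +
        (∑ k ∈ s, ((hubbardTTPrimeFermionInteraction 1 tp U).localHamiltonian Λ' *
              fermionEmbed (PolySite.incl hΛ) (B k) -
            fermionEmbed (PolySite.incl hΛ) (B k) * (hubbardTTPrimeFermionInteraction 1 tp U).localHamiltonian Λ') +
          ∑ l ∈ tt, (fermionEmbed (PolySite.incl (hsh l)) (fermionEmbed (PolySite.d4Emb (γ l) (wv l) Λ) (Y l)) -
            fermionEmbed (PolySite.incl hΛ) (Y l)) +
          ∑ j ∈ uu, b j • ladderWord (cw j)) +
        (∑ m' ∈ ah, ((dc m' : ℝ) : ℂ) • ((V m')ᴴ - V m') + ∑ k ∈ w, a k • ladderWord (word k)))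
    (hr : ((r : ℚ) : ℝ) ≤ (Ecert - hi - ∑ k ∈ w, ‖a k‖ + (∑ σ : Fin 2, μ σ) * (n / 2 - ν)) / lam) :
    SquareTTPrimeCorrOrbitLowerRow tp U n hi r S Λ' Ow := by
  intro ω Ls ψ hLs hψ hψ1 hω hhi
  have h := re_sum_expect_d4_mul_ge_of_lambda_certificate tp hU hn0 hn2 lam hhi hΛ h8 h0 hz h1 hmul Ow μ ν hΛm
    Og s B tt γ hγS wv hsh Y uu b cw hcw ah dc V w a word hcert hLs hψ hψ1 hω
  refine hr.trans ?_
  rw [div_le_iff₀ hlam]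
  linarith

/-- **λ < 0, `D₄`-reduced**: the λ-form energy certificate is a `SquareTTPrimeCorrOrbitLowerRow … S` for `−O`
(an orbit-mean UPPER bound on `O`: `|S|⁻¹ Σ_γ Re ω(Γ(γ)O) ≤ −r`), with any rational
`r ≤ (E_cert − hi − Σ‖aₖ‖ + (Σμ)(n/2 − ν))/(−λ)`. -/
theorem SquareTTPrimeCorrOrbitLowerRow.of_lambda_certificate_neg
    (tp : ℝ) {U : ℝ} (hU : 0 ≤ U) {n : ℝ} (hn0 : 0 ≤ n) (hn2 : n < 2) {lam : ℝ} (hlam : lam < 0)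
    {hi r : ℚ} {Ecert : ℝ}
    {Λ Λ' : Finset (Site 2)} (hΛ : Λ ⊆ Λ') (h8 : thicken Λ 1 ⊆ Λ')
    (h0 : thicken ({0} : Finset (Site 2)) 1 ⊆ Λ') (hz : (0 : Site 2) ∈ Λ')
    {S : Finset (DihedralGroup 4)} (h1 : (1 : DihedralGroup 4) ∈ S) (hmul : ∀ a ∈ S, ∀ b ∈ S, a * b ∈ S)
    (Ow : FermionOp Λ') (μ : Fin 2 → ℝ) (ν : ℝ)
    {m : Type*} [Fintype m] [DecidableEq m] {Λm : Matrix m m ℂ} (hΛm : Λm.PosSemidef)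
    (Og : m → FermionOp Λ')
    {κ' : Type*} (s : Finset κ') (B : κ' → FermionOp Λ)
    {ι : Type*} (tt : Finset ι) (γ : ι → DihedralGroup 4) (hγS : ∀ l ∈ tt, γ l ∈ S) (wv : ι → Site 2)
    (hsh : ∀ l, d4ShiftSet (γ l) (wv l) Λ ⊆ Λ') (Y : ι → FermionOp Λ)
    {ρ : Type*} (uu : Finset ρ) (b : ρ → ℂ) (cw : ρ → List (Orb (PolySite Λ') × Bool))
    (hcw : ∀ j ∈ uu, ladderCharge (cw j) ≠ 0 ∨ ladderSpinCharge (cw j) ≠ 0)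
    {δ : Type*} (ah : Finset δ) (dc : δ → ℝ) (V : δ → FermionOp Λ')
    {κ'' : Type*} (w : Finset κ'') (a : κ'' → ℂ) (word : κ'' → List (Orb (PolySite Λ') × Bool))
    (hcert : ((lam : ℝ) : ℂ) • Ow +
        fermionEmbed (PolySite.incl h0) ((hubbardTTPrimeFermionInteraction 1 tp U).meanEnergyObs 1) -
        ((Ecert : ℝ) : ℂ) • (1 : FermionOp Λ') -
        ∑ σ : Fin 2, ((μ σ : ℝ) : ℂ) • (nAt 0 hz σ - ((ν : ℝ) : ℂ) • (1 : FermionOp Λ')) =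
      gramForm Λm Og +
        (∑ k ∈ s, ((hubbardTTPrimeFermionInteraction 1 tp U).localHamiltonian Λ' *
              fermionEmbed (PolySite.incl hΛ) (B k) -
            fermionEmbed (PolySite.incl hΛ) (B k) * (hubbardTTPrimeFermionInteraction 1 tp U).localHamiltonian Λ') +
          ∑ l ∈ tt, (fermionEmbed (PolySite.incl (hsh l)) (fermionEmbed (PolySite.d4Emb (γ l) (wv l) Λ) (Y l)) -
            fermionEmbed (PolySite.incl hΛ) (Y l)) +
          ∑ j ∈ uu, b j • ladderWord (cw j)) +
        (∑ m' ∈ ah, ((dc m' : ℝ) : ℂ) • ((V m')ᴴ - V m') + ∑ k ∈ w, a k • ladderWord (word k)))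
    (hr : ((r : ℚ) : ℝ) ≤ (Ecert - hi - ∑ k ∈ w, ‖a k‖ + (∑ σ : Fin 2, μ σ) * (n / 2 - ν)) / (-lam)) :
    SquareTTPrimeCorrOrbitLowerRow tp U n hi r S Λ' (-Ow) := by
  intro ω Ls ψ hLs hψ hψ1 hω hhi
  have h := re_sum_expect_d4_mul_ge_of_lambda_certificate tp hU hn0 hn2 lam hhi hΛ h8 h0 hz h1 hmul Ow μ ν hΛm
    Og s B tt γ hγS wv hsh Y uu b cw hcw ah dc V w a word hcert hLs hψ hψ1 hω
  have hsum : ∑ g ∈ S, (ω.expect (d4ShiftSet g 0 Λ') (fermionEmbed (PolySite.d4Emb g 0 Λ') (-Ow))).re =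
      -∑ g ∈ S, (ω.expect (d4ShiftSet g 0 Λ') (fermionEmbed (PolySite.d4Emb g 0 Λ') Ow)).re := by
    rw [← Finset.sum_neg_distrib]
    refine Finset.sum_congr rfl fun g _ => ?_
    rw [map_neg, map_neg, Complex.neg_re]
  rw [hsum]
  refine hr.trans ?_
  have hneg : 0 < -lam := neg_pos.2 hlam
  rw [div_le_iff₀ hneg]
  nlinarith [h]

/-- M3′ wrapper (`U = 8`, `n = 7/8`), `λ > 0`, `D₄`-reduced: `M3CorrOrbitLowerRow tp hi r S Λ' O`. -/
theorem M3CorrOrbitLowerRow.of_lambda_certificate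
    (tp : ℝ) {lam : ℝ} (hlam : 0 < lam) {hi r : ℚ} {Ecert : ℝ}
    {Λ Λ' : Finset (Site 2)} (hΛ : Λ ⊆ Λ') (h8 : thicken Λ 1 ⊆ Λ')
    (h0 : thicken ({0} : Finset (Site 2)) 1 ⊆ Λ') (hz : (0 : Site 2) ∈ Λ')
    {S : Finset (DihedralGroup 4)} (h1 : (1 : DihedralGroup 4) ∈ S) (hmul : ∀ a ∈ S, ∀ b ∈ S, a * b ∈ S)
    (Ow : FermionOp Λ') (μ : Fin 2 → ℝ) (ν : ℝ)
    {m : Type*} [Fintype m] [DecidableEq m] {Λm : Matrix m m ℂ} (hΛm : Λm.PosSemidef)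
    (Og : m → FermionOp Λ')
    {κ' : Type*} (s : Finset κ') (B : κ' → FermionOp Λ)
    {ι : Type*} (tt : Finset ι) (γ : ι → DihedralGroup 4) (hγS : ∀ l ∈ tt, γ l ∈ S) (wv : ι → Site 2)
    (hsh : ∀ l, d4ShiftSet (γ l) (wv l) Λ ⊆ Λ') (Y : ι → FermionOp Λ)
    {ρ : Type*} (uu : Finset ρ) (b : ρ → ℂ) (cw : ρ → List (Orb (PolySite Λ') × Bool))
    (hcw : ∀ j ∈ uu, ladderCharge (cw j) ≠ 0 ∨ ladderSpinCharge (cw j) ≠ 0)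
    {δ : Type*} (ah : Finset δ) (dc : δ → ℝ) (V : δ → FermionOp Λ')
    {κ'' : Type*} (w : Finset κ'') (a : κ'' → ℂ) (word : κ'' → List (Orb (PolySite Λ') × Bool))
    (hcert : ((lam : ℝ) : ℂ) • Ow +
        fermionEmbed (PolySite.incl h0) ((hubbardTTPrimeFermionInteraction 1 tp 8).meanEnergyObs 1) -
        ((Ecert : ℝ) : ℂ) • (1 : FermionOp Λ') -
        ∑ σ : Fin 2, ((μ σ : ℝ) : ℂ) • (nAt 0 hz σ - ((ν : ℝ) : ℂ) • (1 : FermionOp Λ')) =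
      gramForm Λm Og +
        (∑ k ∈ s, ((hubbardTTPrimeFermionInteraction 1 tp 8).localHamiltonian Λ' *
              fermionEmbed (PolySite.incl hΛ) (B k) -
            fermionEmbed (PolySite.incl hΛ) (B k) * (hubbardTTPrimeFermionInteraction 1 tp 8).localHamiltonian Λ') +
          ∑ l ∈ tt, (fermionEmbed (PolySite.incl (hsh l)) (fermionEmbed (PolySite.d4Emb (γ l) (wv l) Λ) (Y l)) -
            fermionEmbed (PolySite.incl hΛ) (Y l)) +
          ∑ j ∈ uu, b j • ladderWord (cw j)) +
        (∑ m' ∈ ah, ((dc m' : ℝ) : ℂ) • ((V m')ᴴ - V m') + ∑ k ∈ w, a k • ladderWord (word k)))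
    (hr : ((r : ℚ) : ℝ) ≤ (Ecert - hi - ∑ k ∈ w, ‖a k‖ + (∑ σ : Fin 2, μ σ) * ((7 / 8 : ℝ) / 2 - ν)) / lam) :
    M3CorrOrbitLowerRow tp hi r S Λ' Ow :=
  SquareTTPrimeCorrOrbitLowerRow.of_lambda_certificate tp (by norm_num) (by norm_num) (by norm_num) hlam hΛ h8 h0
    hz h1 hmul Ow μ ν hΛm Og s B tt γ hγS wv hsh Y uu b cw hcw ah dc V w a word hcert hr

end LambdaOrbit

end Summit.Ventures.CertifiedManyBodySolver

end
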